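import Summits.QuantumFields.YangMills.Theorems.BalabanUVNodesN15KingModelCurvedHTorusProp38
import Summits.QuantumFields.YangMills.Theorems.BalabanUVNodesN18KingModelTorusDerivMassUniform

/-!
# BalabanUVNodes ∕ N15 — THE KING-MODEL RUNG, PART 53: KING's PROPOSITION 3.8 (3.71), ALL FOUR LINES AT `A = 0`, WITH THE CONSTANTS UNIFORM IN THE
# MASS `0 < m² ≤ m₀²` — `Prop38PrintedAt α (kingTwoSpacingH L a m² j n) C δ₀ γ` with ONE `(C, δ₀, γ)` for all masses under a cap, all volumes,
# levels and spacing ratios (Track A, DAG node N15 = NE2, row s3 «King-model rung»; key K3⁸ `SpineGivenEndpointR13SepCoPHV` stmt-QuantumFields-27366 (KEY MAP v2), helper;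
# the mass-uniform edition of PARTS 51∕52 `…N15KingModelCurvedHTorusHolder` ∕ `…Prop38`)

HONEST FRAMING.  Count-neutral kernel bookkeeping (`--kind proof --supports stmt-QuantumFields-27366 --as helper` — the K3⁸ key of dag-lead's KEY MAP v2;
PARTS 51∕52 were filed on the former key 20544, valid by the mis-key rule R463 (4)(a); cell `pub-ymgap`, seat `pub-ymgap-dag-n15-d` g16; n15-e's pointer (iii)
«the mass-uniform rows if you want one constant for all m²»).  King's `A = 0` SCALAR MODEL
([King1986], TEMPLATE literature, printed AND kernel-proved on Bałaban's tori; the mass-uniform torus theorems are the n18-e ∕ n15-e editions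
`N18KingModelTorusMassUniform.minimiser_row_rate_unif`, `N18KingModelTorusDerivMassUniform.dminimiser_row_rate_unif`,
`King1986.Torus.king_prop38_holder(_deriv)_torus_blocks_unif`); this file ASSEMBLES them BY NAME.  NOT [Ba 4] at `A ≠ 0`, NOT Bałaban's `H_k(U)`;
NE2⁺ NOT PRINTED; N15 NOT discharged; K3⁷ OPEN, not claimed; counts UNMOVED (typed 28∕28 · discharged 5∕27, A 5∕28); finite tori — nothing continuum ∕
ℝ⁴ ∕ OS ∕ mass-gap ∕ Clay.  THEOREMS ONLY: 0 `def`, 0 `sorry`, standard axioms.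

WHY THE MASS INSIDE THE `∃`.  King's slices (2.17) of scale `j`, read in their own lattice units, carry the mass `m²(L^jη)²` ((2.20) p. 654) — a
different number at every scale, all in `(0, m²]`; a bound summed over `j` (Prop. 3.9, or the slice families of n15-e's PART F) needs ONE triple of
constants for all masses under a cap.  PARTS 51∕52 fix `m²` before producing `(C, δ₀, γ)` (lines 1–2 there come from PART C's fixed-mass
`kingH_twoSpacing_le`); here every line is re-assembled from the mass-uniform tree theorems.
WHAT.  In the letters of PART 51's point-distance datum `kingTwoSpacingH L a m² j n` (kernels `K = ℋ_K(·, B(z))`, `K′ = ℋ_{K+n}(·, B(z))`, `dK`, `dK′`,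
`pt = underPtN`, `dist = holdist`):
* `line1_kingTwoSpacingH_unif` ∕ `line2_kingTwoSpacingH_unif` — for odd `L ≥ 3`, `a > 0`, a cap `m₀² ≥ 0`, `0 ≤ γ ≤ 1` (resp. `< 1`) ONE `(C, δ)` with
  `|K′(x′, z) − K(pt x′, z)| ≤ C·L^{−(γ∕2)K}·e^{−δ|pt x′ − z|}` (and the `dK` line) for EVERY `0 < m² ≤ m₀²`, index `j`, `n ≥ 1`, `x′`, `z`
  (`(d)minimiser_row_rate_unif` at `κ = δ₀∕2` + `N18KingModelTorus(Deriv).(d)outerRate_le_unif` + PART 51 §2).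
* `line3_kingTwoSpacingH_unif` ∕ `line4_kingTwoSpacingH_unif` — the Hölder lines at a FIXED `α` (`α + γ ≤ 1`, resp. `< 1`), mass-uniform
  (`king_prop38_holder(_deriv)_torus_blocks_unif` at the free cap + `N18KingModelScalesPair.fprop38Const_le_unif` ∕ `sqrt_rate_le_unif` + PART 51 §2).
* ★★ **`prop38PrintedAt_kingTwoSpacingH_unif`**: for every `0 < α < 1` there are `C, δ₀, γ > 0` (`γ = (1 − α)∕4`) with
  `Prop38PrintedAt α (kingTwoSpacingH L a m² j n) C δ₀ γ` for EVERY mass `0 < m² ≤ m₀²`, every volume∕scale index `j` and every `n ≥ 1`.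
The quantifier order of the typer's `Prop38Printed` (α inside) is discussed in PART 52's header; nothing of it is claimed here.
Locators: [King1986] C. King, CMP **102** (1986) 649–677: (2.20) p. 654, (3.62) p. 663, Prop. 3.8 (3.71) p. 664, §4 pp. 673–674;
[Ba 4] = [Balaban1983RegularityDecay] CMP **89** (1983) Thm (1.9)–(1.10) p. 573 (mass-free constants; the decay inputs, via the tree).
-/

noncomputable section

namespace Summit.QuantumFields.YangMills.BalabanUVNodes.N15.KingModel

open Real Finset
open Literature.MathematicalPhysics.QuantumFieldTheory.Balaban1983to89
open Literature.MathematicalPhysics.QuantumFieldTheory.Balaban1983to89.B5Prop11Plancherel (Tor fine unitVec)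
open Literature.MathematicalPhysics.QuantumFieldTheory.King1986 (aK prop38RateConst prop38PosConst dprop38RateConst dprop38PosConst fprop38RateConst
  fprop38PosConst lemma43Const aliasConst)
open Literature.MathematicalPhysics.QuantumFieldTheory.King1986.Torus (blockOf tdistT tdistT_nonneg holdist holdist_nonneg
  king_prop38_holder_torus_blocks_unif king_prop38_holder_deriv_torus_blocks_unif)
open Literature.MathematicalPhysics.QuantumFieldTheory.King1986.SlicePropagator (TwoSpacing holderDeriv)
open Summit.QuantumFields.YangMills.BalabanUVNodes.N18KingModelTorus (outerRate_le_unif)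
open Summit.QuantumFields.YangMills.BalabanUVNodes.N18KingModelTorusDeriv (douterRate_le_unif)
open Summit.QuantumFields.YangMills.BalabanUVNodes.N18KingModelTorusMassUniform (minimiser_row_rate_unif)
open Summit.QuantumFields.YangMills.BalabanUVNodes.N18KingModelTorusDerivMassUniform (dminimiser_row_rate_unif)
open Summit.QuantumFields.YangMills.BalabanUVNodes.N18KingModelScalesPair (fprop38Const_le_unif sqrt_rate_le_unif aliasConst_nonneg_of_lt_one)
open Summit.QuantumFields.YangMills.BalabanUVNodes.N15KingModelRung (KingVolIndex kingVol kingVol_neZero kingVol_eq_sitesPerDir kingH dkingH)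
open Summit.QuantumFields.YangMills.BalabanUVNodes.N15KingModelRung.Curved (underPtN val_underPtN theta_pow_eq_rpow)

variable {d : ℕ} (L : ℕ) [NeZero L]

/-! ## §1 Lines 1–2, constants uniform in the mass -/

/-- **(3.71) LINE 1 FOR THE POINT-DISTANCE DATUM, CONSTANTS UNIFORM IN THE MASS** (odd `L ≥ 3`, `a > 0`, cap `m₀² ≥ 0`, `0 ≤ γ ≤ 1`): ONE `(C, δ)`
with `|K′(x′, z) − K(pt x′, z)| ≤ C·L^{−(γ∕2)K}·e^{−δ·|pt x′ − z|}` on `kingTwoSpacingH L a m² j n` for EVERY `0 < m² ≤ m₀²`, `j`, `n ≥ 1`, `x′`, `z` —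
n18-e's `minimiser_row_rate_unif` at `κ = δ₀∕2`, `outerRate_le_unif`, PART 51's `exp_blockDist_le_exp_holdist`. [cite: King1986, Prop. 3.8 (3.71) p.664 (first line), (2.20) p.654] -/
theorem line1_kingTwoSpacingH_unif (hLodd : Odd L) (hL : 2 ≤ L) {a : ℝ} (ha : 0 < a) {m0sq : ℝ} (hm0 : 0 ≤ m0sq) {γ : ℝ}
    (hγ0 : 0 ≤ γ) (hγ1 : γ ≤ 1) :
    ∃ C δ : ℝ, 0 < C ∧ 0 < δ ∧ ∀ (m2 : ℝ) (_hm : 0 < m2) (_hcap : m2 ≤ m0sq) (j : KingVolIndex d) (n : ℕ) (_hn : 1 ≤ n)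
      (x' : (kingTwoSpacingH L a m2 j n).hi.S) (z : (kingTwoSpacingH L a m2 j n).lo.S),
      |(kingTwoSpacingH L a m2 j n).K' x' z - (kingTwoSpacingH L a m2 j n).K ((kingTwoSpacingH L a m2 j n).pt x') z|
        ≤ C * ((kingTwoSpacingH L a m2 j n).lo.L : ℝ) ^ (-(γ / 2 * (kingTwoSpacingH L a m2 j n).lo.k))
          * Real.exp (-(δ * (kingTwoSpacingH L a m2 j n).lo.dist ((kingTwoSpacingH L a m2 j n).pt x') z)) := by
  obtain ⟨δ₀, c₀, hδ₀, hc₀, H⟩ := minimiser_row_rate_unif (d + 1) L (Nat.succ_pos d) hLodd hL ha hm0 hγ0 hγ1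
  set Cu : ℝ := prop38RateConst a a (a * (2 * ((a * (1 - ((L : ℝ) ^ 2)⁻¹))⁻¹ + π ^ 2 / 48 + 1 / 3)))
      ((π ^ 2 / 4) ^ (d + 1)) (d + 1) γ + prop38PosConst a ((π ^ 2 / 4) ^ (d + 1)) (d + 1) γ with hCu
  refine ⟨(Real.sqrt (2 * (a * c₀) * Cu) + 1) * Real.exp (δ₀ / 2), δ₀ / 2, by positivity, half_pos hδ₀,
    fun m2 hm hcap j n hn x' z => ?_⟩
  haveI := kingVol_neZero L j
  set b := blockOf (L ^ j.K) (kingVol L j) z with hb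
  have hj := H (j.params L hLodd hL) rfl rfl j.one_le_K m2 hm hcap n hn (kingVol L j) (kingVol_eq_sitesPerDir L hLodd hL j)
    (δ₀ / 2) (half_pos hδ₀) le_rfl (underPtN L j.K n (kingVol L j) x') x' b (val_underPtN L j.K n (kingVol L j) x')
  have hC := outerRate_le_unif (d := d + 1) (Nat.succ_pos d) ha hL j.one_le_K hn hγ1 hc₀.le (K := j.K)
  rw [theta_pow_eq_rpow] at hC
  set r : ℝ := (L : ℝ) ^ (-(γ / 2 * (j.K : ℝ))) with hr_def
  have hr : 0 ≤ r := Real.rpow_nonneg (Nat.cast_nonneg _) _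
  set E : ℝ := Real.exp (-(δ₀ / 2 * tdistT (kingVol L j) (blockOf (L ^ j.K) (kingVol L j) (underPtN L j.K n (kingVol L j) x')) b))
    with hE
  have hcmp := exp_blockDist_le_exp_holdist (L ^ j.K) (kingVol L j) (half_pos hδ₀).le (underPtN L j.K n (kingVol L j) x') z
  show |kingH L (L ^ n * L ^ j.K) (kingVol L j) a m2 (j.K + n) b x' - kingH L (L ^ j.K) (kingVol L j) a m2 j.K b (underPtN L j.K n (kingVol L j) x')|
      ≤ (Real.sqrt (2 * (a * c₀) * Cu) + 1) * Real.exp (δ₀ / 2) * r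
        * Real.exp (-(δ₀ / 2 * holdist (L ^ j.K) (kingVol L j) (underPtN L j.K n (kingVol L j) x') z))
  calc _ ≤ Real.sqrt ((prop38RateConst a a (lemma43Const a L j.K n) ((π ^ 2 / 4) ^ (d + 1)) (d + 1) γ
            + prop38PosConst a ((π ^ 2 / 4) ^ (d + 1)) (d + 1) γ) * ((L ^ j.K : ℕ) : ℝ) ^ (-γ) * (2 * (a * c₀))) * E := hj
    _ ≤ Real.sqrt (2 * (a * c₀) * Cu) * r * E := mul_le_mul_of_nonneg_right hC (Real.exp_pos _).le
    _ ≤ (Real.sqrt (2 * (a * c₀) * Cu) + 1) * r * E :=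
        mul_le_mul_of_nonneg_right (mul_le_mul_of_nonneg_right (by linarith) hr) (Real.exp_pos _).le
    _ ≤ (Real.sqrt (2 * (a * c₀) * Cu) + 1) * r
          * (Real.exp (δ₀ / 2) * Real.exp (-(δ₀ / 2 * holdist (L ^ j.K) (kingVol L j) (underPtN L j.K n (kingVol L j) x') z))) :=
        mul_le_mul_of_nonneg_left hcmp (by positivity)
    _ = _ := by ring

/-- **(3.71) LINE 2 FOR THE POINT-DISTANCE DATUM, CONSTANTS UNIFORM IN THE MASS** (`0 ≤ γ < 1`): ONE `(C, δ)` with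
`|dK′_μ(x′, z) − dK_μ(pt x′, z)| ≤ C·L^{−(γ∕2)K}·e^{−δ·|pt x′ − z|}` for EVERY `0 < m² ≤ m₀²`, `j`, `n ≥ 1`, `μ`, `x′`, `z` — n18-e's
`dminimiser_row_rate_unif` + `douterRate_le_unif` + PART 51 §2. [cite: King1986, Prop. 3.8 (3.71) p.664 (second line), (2.20) p.654] -/
theorem line2_kingTwoSpacingH_unif (hLodd : Odd L) (hL : 2 ≤ L) {a : ℝ} (ha : 0 < a) {m0sq : ℝ} (hm0 : 0 ≤ m0sq) {γ : ℝ}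
    (hγ0 : 0 ≤ γ) (hγ1 : γ < 1) :
    ∃ C δ : ℝ, 0 < C ∧ 0 < δ ∧ ∀ (m2 : ℝ) (_hm : 0 < m2) (_hcap : m2 ≤ m0sq) (j : KingVolIndex d) (n : ℕ) (_hn : 1 ≤ n)
      (x' : (kingTwoSpacingH L a m2 j n).hi.S) (z : (kingTwoSpacingH L a m2 j n).lo.S) (μ : Fin (d + 1)),
      |(kingTwoSpacingH L a m2 j n).dK' μ x' z - (kingTwoSpacingH L a m2 j n).dK μ ((kingTwoSpacingH L a m2 j n).pt x') z|
        ≤ C * ((kingTwoSpacingH L a m2 j n).lo.L : ℝ) ^ (-(γ / 2 * (kingTwoSpacingH L a m2 j n).lo.k))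
          * Real.exp (-(δ * (kingTwoSpacingH L a m2 j n).lo.dist ((kingTwoSpacingH L a m2 j n).pt x') z)) := by
  obtain ⟨δ₀, c₀, hδ₀, hc₀, H⟩ := dminimiser_row_rate_unif (d + 1) L (Nat.succ_pos d) hLodd hL ha hm0 hγ0 hγ1
  set Cu : ℝ := dprop38RateConst a a (a * (2 * ((a * (1 - ((L : ℝ) ^ 2)⁻¹))⁻¹ + π ^ 2 / 48 + 1 / 3)))
      ((π ^ 2 / 4) ^ (d + 1)) (d + 1) γ + dprop38PosConst a ((π ^ 2 / 4) ^ (d + 1)) (d + 1) γ with hCu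
  refine ⟨(Real.sqrt (2 * (a * c₀) * Cu) + 1) * Real.exp (δ₀ / 2), δ₀ / 2, by positivity, half_pos hδ₀,
    fun m2 hm hcap j n hn x' z μ => ?_⟩
  haveI := kingVol_neZero L j
  set b := blockOf (L ^ j.K) (kingVol L j) z with hb
  have hj := H (j.params L hLodd hL) rfl rfl j.one_le_K m2 hm hcap n hn (kingVol L j) (kingVol_eq_sitesPerDir L hLodd hL j)
    (δ₀ / 2) (half_pos hδ₀) le_rfl (underPtN L j.K n (kingVol L j) x') x' b (val_underPtN L j.K n (kingVol L j) x') μ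
  have hC := douterRate_le_unif (d := d + 1) (Nat.succ_pos d) ha hL j.one_le_K hn hγ1 hc₀.le (K := j.K)
  rw [theta_pow_eq_rpow] at hC
  set r : ℝ := (L : ℝ) ^ (-(γ / 2 * (j.K : ℝ))) with hr_def
  have hr : 0 ≤ r := Real.rpow_nonneg (Nat.cast_nonneg _) _
  set E : ℝ := Real.exp (-(δ₀ / 2 * tdistT (kingVol L j) (blockOf (L ^ j.K) (kingVol L j) (underPtN L j.K n (kingVol L j) x')) b))
    with hE
  have hcmp := exp_blockDist_le_exp_holdist (L ^ j.K) (kingVol L j) (half_pos hδ₀).le (underPtN L j.K n (kingVol L j) x') z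
  show |dkingH L (L ^ n * L ^ j.K) (kingVol L j) a m2 (j.K + n) b μ x'
        - dkingH L (L ^ j.K) (kingVol L j) a m2 j.K b μ (underPtN L j.K n (kingVol L j) x')|
      ≤ (Real.sqrt (2 * (a * c₀) * Cu) + 1) * Real.exp (δ₀ / 2) * r
        * Real.exp (-(δ₀ / 2 * holdist (L ^ j.K) (kingVol L j) (underPtN L j.K n (kingVol L j) x') z))
  calc _ ≤ Real.sqrt ((dprop38RateConst a a (lemma43Const a L j.K n) ((π ^ 2 / 4) ^ (d + 1)) (d + 1) γ
            + dprop38PosConst a ((π ^ 2 / 4) ^ (d + 1)) (d + 1) γ) * ((L ^ j.K : ℕ) : ℝ) ^ (-γ) * (2 * (a * c₀))) * E := hj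
    _ ≤ Real.sqrt (2 * (a * c₀) * Cu) * r * E := mul_le_mul_of_nonneg_right hC (Real.exp_pos _).le
    _ ≤ (Real.sqrt (2 * (a * c₀) * Cu) + 1) * r * E :=
        mul_le_mul_of_nonneg_right (mul_le_mul_of_nonneg_right (by linarith) hr) (Real.exp_pos _).le
    _ ≤ (Real.sqrt (2 * (a * c₀) * Cu) + 1) * r
          * (Real.exp (δ₀ / 2) * Real.exp (-(δ₀ / 2 * holdist (L ^ j.K) (kingVol L j) (underPtN L j.K n (kingVol L j) x') z))) :=
        mul_le_mul_of_nonneg_left hcmp (by positivity)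
    _ = _ := by ring

/-! ## §2 Lines 3–4 at a fixed Hölder exponent, constants uniform in the mass -/

/-- **(3.71) LINE 3 FOR THE POINT-DISTANCE DATUM AT A FIXED `α`, CONSTANTS UNIFORM IN THE MASS** (`0 < α`, `0 < γ`, `α + γ ≤ 1`, cap `m₀² ≥ 0`):
ONE `(C, δ)` with `|∂_α(x′, y′)K′(z) − ∂_α(pt x′, pt y′)K(z)| ≤ C·L^{−(γ∕2)K}·e^{−δ·min(|pt x′ − z|, |pt y′ − z|)}` for EVERY `0 < m² ≤ m₀²`, `j`,
`n ≥ 1`, `x′, y′`, `z` — `king_prop38_holder_torus_blocks_unif` at the cap, `fprop38Const_le_unif` ∕ `sqrt_rate_le_unif`, PART 51's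
`exp_blockDist_min_le_exp_holdist_min`. [cite: King1986, (3.62) p.663, Prop. 3.8 (3.71) p.664 (third line), (2.20) p.654] -/
theorem line3_kingTwoSpacingH_unif (hLodd : Odd L) (hL : 2 ≤ L) {a : ℝ} (ha : 0 < a) {m0sq : ℝ} (hm0 : 0 ≤ m0sq) {α γ : ℝ}
    (hα : 0 < α) (hγ : 0 < γ) (hαγ : α + γ ≤ 1) :
    ∃ C δ : ℝ, 0 < C ∧ 0 < δ ∧ ∀ (m2 : ℝ) (_hm : 0 < m2) (_hcap : m2 ≤ m0sq) (j : KingVolIndex d) (n : ℕ) (_hn : 1 ≤ n)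
      (x' y' : (kingTwoSpacingH L a m2 j n).hi.S) (z : (kingTwoSpacingH L a m2 j n).lo.S),
      |holderDeriv (kingTwoSpacingH L a m2 j n).hi.dist α (kingTwoSpacingH L a m2 j n).K' x' y' z
          - holderDeriv (kingTwoSpacingH L a m2 j n).lo.dist α (kingTwoSpacingH L a m2 j n).K
              ((kingTwoSpacingH L a m2 j n).pt x') ((kingTwoSpacingH L a m2 j n).pt y') z|
        ≤ C * ((kingTwoSpacingH L a m2 j n).lo.L : ℝ) ^ (-(γ / 2 * (kingTwoSpacingH L a m2 j n).lo.k))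
          * Real.exp (-(δ * min ((kingTwoSpacingH L a m2 j n).lo.dist ((kingTwoSpacingH L a m2 j n).pt x') z)
              ((kingTwoSpacingH L a m2 j n).lo.dist ((kingTwoSpacingH L a m2 j n).pt y') z))) := by
  obtain ⟨δ₀, c₀, hδ₀, hc₀, H⟩ :=
    king_prop38_holder_torus_blocks_unif (d + 1) L (Nat.succ_pos d) hLodd hL ha hm0 hα hγ hαγ
  set Cu : ℝ := fprop38RateConst a a (a * (2 * ((a * (1 - ((L : ℝ) ^ 2)⁻¹))⁻¹ + π ^ 2 / 48 + 1 / 3)))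
      ((π ^ 2 / 4) ^ (d + 1)) (d + 1) γ α (2 * ((d + 1 : ℕ) : ℝ) ^ α) 0
    + fprop38PosConst a ((π ^ 2 / 4) ^ (d + 1)) (d + 1) γ α (2 * ((d + 1 : ℕ) : ℝ) ^ α) (6 * ((d + 1 : ℕ) : ℝ) ^ (α + γ))
    with hCu
  refine ⟨(Real.sqrt (2 * c₀ * Cu) + 1) * Real.exp (δ₀ / 2), δ₀ / 2, by positivity, half_pos hδ₀,
    fun m2 hm hcap j n hn x' y' z => ?_⟩
  haveI := kingVol_neZero L j
  set b := blockOf (L ^ j.K) (kingVol L j) z with hb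
  have hj := H (j.params L hLodd hL) rfl rfl j.one_le_K m2 hm hcap n hn (kingVol L j) (kingVol_eq_sitesPerDir L hLodd hL j)
    (underPtN L j.K n (kingVol L j) x') (underPtN L j.K n (kingVol L j) y') x' y' b
    (val_underPtN L j.K n (kingVol L j) x') (val_underPtN L j.K n (kingVol L j) y')
  set Ck : ℝ := fprop38RateConst a a (lemma43Const a L j.K n) ((π ^ 2 / 4) ^ (d + 1)) (d + 1) γ α (2 * ((d + 1 : ℕ) : ℝ) ^ α) 0
    + fprop38PosConst a ((π ^ 2 / 4) ^ (d + 1)) (d + 1) γ α (2 * ((d + 1 : ℕ) : ℝ) ^ α) (6 * ((d + 1 : ℕ) : ℝ) ^ (α + γ))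
    with hCk
  have hAC : 0 ≤ aliasConst (d + 1) (α + γ - 1) := aliasConst_nonneg_of_lt_one (d := d + 1) (Nat.succ_pos d) (by linarith)
  have hCle : Ck ≤ Cu := fprop38Const_le_unif (d := d + 1) ha hL j.one_le_K hn (V := (π ^ 2 / 4) ^ (d + 1)) (γ := γ) (β := α)
    (cE := 2 * ((d + 1 : ℕ) : ℝ) ^ α) (rE := 0) (sE := 6 * ((d + 1 : ℕ) : ℝ) ^ (α + γ)) (by positivity) (by positivity) hAC
  have hC := sqrt_rate_le_unif hCle (by positivity : (0 : ℝ) ≤ 2 * c₀) L j.K γ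
  rw [theta_pow_eq_rpow] at hC
  set r : ℝ := (L : ℝ) ^ (-(γ / 2 * (j.K : ℝ))) with hr_def
  have hr : 0 ≤ r := Real.rpow_nonneg (Nat.cast_nonneg _) _
  set E : ℝ := Real.exp (-(δ₀ / 2 * min (tdistT (kingVol L j) (blockOf (L ^ j.K) (kingVol L j) (underPtN L j.K n (kingVol L j) x')) b)
      (tdistT (kingVol L j) (blockOf (L ^ j.K) (kingVol L j) (underPtN L j.K n (kingVol L j) y')) b))) with hE
  have hcmp := exp_blockDist_min_le_exp_holdist_min (L ^ j.K) (kingVol L j) (half_pos hδ₀).le (underPtN L j.K n (kingVol L j) x')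
    (underPtN L j.K n (kingVol L j) y') z
  unfold holderDeriv
  show |(holdist (L ^ n * L ^ j.K) (kingVol L j) x' y') ^ (-α)
          * (kingH L (L ^ n * L ^ j.K) (kingVol L j) a m2 (j.K + n) b x' - kingH L (L ^ n * L ^ j.K) (kingVol L j) a m2 (j.K + n) b y')
        - (holdist (L ^ j.K) (kingVol L j) (underPtN L j.K n (kingVol L j) x') (underPtN L j.K n (kingVol L j) y')) ^ (-α)
          * (kingH L (L ^ j.K) (kingVol L j) a m2 j.K b (underPtN L j.K n (kingVol L j) x')
            - kingH L (L ^ j.K) (kingVol L j) a m2 j.K b (underPtN L j.K n (kingVol L j) y'))|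
      ≤ (Real.sqrt (2 * c₀ * Cu) + 1) * Real.exp (δ₀ / 2) * r
        * Real.exp (-(δ₀ / 2 * min (holdist (L ^ j.K) (kingVol L j) (underPtN L j.K n (kingVol L j) x') z)
            (holdist (L ^ j.K) (kingVol L j) (underPtN L j.K n (kingVol L j) y') z)))
  calc _ ≤ Real.sqrt (Ck * ((L ^ j.K : ℕ) : ℝ) ^ (-γ) * (2 * c₀)) * E := hj
    _ ≤ Real.sqrt (2 * c₀ * Cu) * r * E := mul_le_mul_of_nonneg_right hC (Real.exp_pos _).le
    _ ≤ (Real.sqrt (2 * c₀ * Cu) + 1) * r * E :=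
        mul_le_mul_of_nonneg_right (mul_le_mul_of_nonneg_right (by linarith) hr) (Real.exp_pos _).le
    _ ≤ (Real.sqrt (2 * c₀ * Cu) + 1) * r
          * (Real.exp (δ₀ / 2) * Real.exp (-(δ₀ / 2 * min (holdist (L ^ j.K) (kingVol L j) (underPtN L j.K n (kingVol L j) x') z)
            (holdist (L ^ j.K) (kingVol L j) (underPtN L j.K n (kingVol L j) y') z)))) :=
        mul_le_mul_of_nonneg_left hcmp (by positivity)
    _ = _ := by ring

/-- **(3.71) LINE 4 FOR THE POINT-DISTANCE DATUM AT A FIXED `α`, CONSTANTS UNIFORM IN THE MASS** (`0 < α`, `0 < γ`, `α + γ < 1`, cap `m₀² ≥ 0`):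
ONE `(C, δ)` with `|∂_α(x′, y′)dK′_μ(z) − ∂_α(pt x′, pt y′)dK_μ(z)| ≤ C·L^{−(γ∕2)K}·e^{−δ·min(|pt x′ − z|, |pt y′ − z|)}` for EVERY `0 < m² ≤ m₀²`,
`j`, `n ≥ 1`, `μ`, `x′, y′`, `z` — `king_prop38_holder_deriv_torus_blocks_unif` at the cap + the same uniformisation. [cite: King1986, (3.62) p.663, Prop. 3.8 (3.71) p.664 (fourth line), (2.20) p.654] -/
theorem line4_kingTwoSpacingH_unif (hLodd : Odd L) (hL : 2 ≤ L) {a : ℝ} (ha : 0 < a) {m0sq : ℝ} (hm0 : 0 ≤ m0sq) {α γ : ℝ}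
    (hα : 0 < α) (hγ : 0 < γ) (hαγ : α + γ < 1) :
    ∃ C δ : ℝ, 0 < C ∧ 0 < δ ∧ ∀ (m2 : ℝ) (_hm : 0 < m2) (_hcap : m2 ≤ m0sq) (j : KingVolIndex d) (n : ℕ) (_hn : 1 ≤ n)
      (x' y' : (kingTwoSpacingH L a m2 j n).hi.S) (z : (kingTwoSpacingH L a m2 j n).lo.S) (μ : Fin (d + 1)),
      |holderDeriv (kingTwoSpacingH L a m2 j n).hi.dist α ((kingTwoSpacingH L a m2 j n).dK' μ) x' y' z
          - holderDeriv (kingTwoSpacingH L a m2 j n).lo.dist α ((kingTwoSpacingH L a m2 j n).dK μ)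
              ((kingTwoSpacingH L a m2 j n).pt x') ((kingTwoSpacingH L a m2 j n).pt y') z|
        ≤ C * ((kingTwoSpacingH L a m2 j n).lo.L : ℝ) ^ (-(γ / 2 * (kingTwoSpacingH L a m2 j n).lo.k))
          * Real.exp (-(δ * min ((kingTwoSpacingH L a m2 j n).lo.dist ((kingTwoSpacingH L a m2 j n).pt x') z)
              ((kingTwoSpacingH L a m2 j n).lo.dist ((kingTwoSpacingH L a m2 j n).pt y') z))) := by
  obtain ⟨δ₀, c₀, hδ₀, hc₀, H⟩ :=
    king_prop38_holder_deriv_torus_blocks_unif (d + 1) L (Nat.succ_pos d) hLodd hL ha hm0 hα hγ hαγ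
  set Cu : ℝ := fprop38RateConst a a (a * (2 * ((a * (1 - ((L : ℝ) ^ 2)⁻¹))⁻¹ + π ^ 2 / 48 + 1 / 3)))
      ((π ^ 2 / 4) ^ (d + 1)) (d + 1) γ (α + 1) (2 * ((d + 1 : ℕ) : ℝ) ^ α) (2 * ((d + 1 : ℕ) : ℝ) ^ α * 2 ^ (1 - γ))
    + fprop38PosConst a ((π ^ 2 / 4) ^ (d + 1)) (d + 1) γ (α + 1) (2 * ((d + 1 : ℕ) : ℝ) ^ α) (6 * ((d + 1 : ℕ) : ℝ) ^ (α + γ))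
    with hCu
  refine ⟨(Real.sqrt (2 * c₀ * Cu) + 1) * Real.exp (δ₀ / 2), δ₀ / 2, by positivity, half_pos hδ₀,
    fun m2 hm hcap j n hn x' y' z μ => ?_⟩
  haveI := kingVol_neZero L j
  set b := blockOf (L ^ j.K) (kingVol L j) z with hb
  have hj := H (j.params L hLodd hL) rfl rfl j.one_le_K m2 hm hcap n hn (kingVol L j) (kingVol_eq_sitesPerDir L hLodd hL j)
    (underPtN L j.K n (kingVol L j) x') (underPtN L j.K n (kingVol L j) y') x' y' b
    (val_underPtN L j.K n (kingVol L j) x') (val_underPtN L j.K n (kingVol L j) y') μ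
  set Ck : ℝ := fprop38RateConst a a (lemma43Const a L j.K n) ((π ^ 2 / 4) ^ (d + 1)) (d + 1) γ (α + 1) (2 * ((d + 1 : ℕ) : ℝ) ^ α)
      (2 * ((d + 1 : ℕ) : ℝ) ^ α * 2 ^ (1 - γ))
    + fprop38PosConst a ((π ^ 2 / 4) ^ (d + 1)) (d + 1) γ (α + 1) (2 * ((d + 1 : ℕ) : ℝ) ^ α) (6 * ((d + 1 : ℕ) : ℝ) ^ (α + γ))
    with hCk
  have hAC : 0 ≤ aliasConst (d + 1) (α + 1 + γ - 1) := by
    rw [show α + 1 + γ - 1 = α + γ by ring]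
    exact aliasConst_nonneg_of_lt_one (d := d + 1) (Nat.succ_pos d) hαγ
  have hCle : Ck ≤ Cu := fprop38Const_le_unif (d := d + 1) ha hL j.one_le_K hn (V := (π ^ 2 / 4) ^ (d + 1)) (γ := γ) (β := α + 1)
    (cE := 2 * ((d + 1 : ℕ) : ℝ) ^ α) (rE := 2 * ((d + 1 : ℕ) : ℝ) ^ α * 2 ^ (1 - γ)) (sE := 6 * ((d + 1 : ℕ) : ℝ) ^ (α + γ))
    (by positivity) (by positivity) hAC
  have hC := sqrt_rate_le_unif hCle (by positivity : (0 : ℝ) ≤ 2 * c₀) L j.K γ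
  rw [theta_pow_eq_rpow] at hC
  set r : ℝ := (L : ℝ) ^ (-(γ / 2 * (j.K : ℝ))) with hr_def
  have hr : 0 ≤ r := Real.rpow_nonneg (Nat.cast_nonneg _) _
  set E : ℝ := Real.exp (-(δ₀ / 2 * min (tdistT (kingVol L j) (blockOf (L ^ j.K) (kingVol L j) (underPtN L j.K n (kingVol L j) x')) b)
      (tdistT (kingVol L j) (blockOf (L ^ j.K) (kingVol L j) (underPtN L j.K n (kingVol L j) y')) b))) with hE
  have hcmp := exp_blockDist_min_le_exp_holdist_min (L ^ j.K) (kingVol L j) (half_pos hδ₀).le (underPtN L j.K n (kingVol L j) x')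
    (underPtN L j.K n (kingVol L j) y') z
  unfold holderDeriv
  show |(holdist (L ^ n * L ^ j.K) (kingVol L j) x' y') ^ (-α)
          * (dkingH L (L ^ n * L ^ j.K) (kingVol L j) a m2 (j.K + n) b μ x' - dkingH L (L ^ n * L ^ j.K) (kingVol L j) a m2 (j.K + n) b μ y')
        - (holdist (L ^ j.K) (kingVol L j) (underPtN L j.K n (kingVol L j) x') (underPtN L j.K n (kingVol L j) y')) ^ (-α)
          * (dkingH L (L ^ j.K) (kingVol L j) a m2 j.K b μ (underPtN L j.K n (kingVol L j) x')
            - dkingH L (L ^ j.K) (kingVol L j) a m2 j.K b μ (underPtN L j.K n (kingVol L j) y'))|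
      ≤ (Real.sqrt (2 * c₀ * Cu) + 1) * Real.exp (δ₀ / 2) * r
        * Real.exp (-(δ₀ / 2 * min (holdist (L ^ j.K) (kingVol L j) (underPtN L j.K n (kingVol L j) x') z)
            (holdist (L ^ j.K) (kingVol L j) (underPtN L j.K n (kingVol L j) y') z)))
  calc _ ≤ Real.sqrt (Ck * ((L ^ j.K : ℕ) : ℝ) ^ (-γ) * (2 * c₀)) * E := hj
    _ ≤ Real.sqrt (2 * c₀ * Cu) * r * E := mul_le_mul_of_nonneg_right hC (Real.exp_pos _).le
    _ ≤ (Real.sqrt (2 * c₀ * Cu) + 1) * r * E :=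
        mul_le_mul_of_nonneg_right (mul_le_mul_of_nonneg_right (by linarith) hr) (Real.exp_pos _).le
    _ ≤ (Real.sqrt (2 * c₀ * Cu) + 1) * r
          * (Real.exp (δ₀ / 2) * Real.exp (-(δ₀ / 2 * min (holdist (L ^ j.K) (kingVol L j) (underPtN L j.K n (kingVol L j) x') z)
            (holdist (L ^ j.K) (kingVol L j) (underPtN L j.K n (kingVol L j) y') z)))) :=
        mul_le_mul_of_nonneg_left hcmp (by positivity)
    _ = _ := by ring

/-! ## §3 The schema's (3.71) at a fixed Hölder exponent for King's `A = 0` data, one triple of constants for all masses under a cap -/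

/-- ★★ **KING's PROPOSITION 3.8 (3.71), ALL FOUR LINES, FOR THE `A = 0` MINIMISERS ON BAŁABAN's VOLUMES — CONSTANTS UNIFORM IN THE MASS.**
For odd `L ≥ 3`, `a > 0`, a cap `m₀² ≥ 0` and every Hölder exponent `0 < α < 1` there are `C, δ₀, γ > 0` (functions of `d, L, a, m₀², α`;
`γ = (1 − α)∕4`) such that `Prop38PrintedAt α (kingTwoSpacingH L a m² j n) C δ₀ γ` for EVERY mass `0 < m² ≤ m₀²`, every volume∕scale index
`j` (unit torus `2L^m`, `K ≥ 1`) and every `n ≥ 1` — the (2.20)-ready form of PART 52's `prop38PrintedAt_kingTwoSpacingH` (which fixes `m²`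
first).  Assembly: §1–§2 at the inner exponent `γ₀ = (1 − α)∕2`, `C = max`, `δ₀ = min`, `γ = γ₀∕2`.  King's `A = 0` MODEL — NOT [Ba 4] at
`A ≠ 0`, NOT Bałaban's `H_k(U)`. [cite: King1986, Prop. 3.8 (3.71) p.664, (2.20) p.654, §4 pp.673–674] -/
theorem prop38PrintedAt_kingTwoSpacingH_unif (hLodd : Odd L) (hL : 2 ≤ L) {a : ℝ} (ha : 0 < a) {m0sq : ℝ} (hm0 : 0 ≤ m0sq) {α : ℝ}
    (hα0 : 0 < α) (hα1 : α < 1) :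
    ∃ C δ₀ γ : ℝ, 0 < C ∧ 0 < δ₀ ∧ 0 < γ ∧ ∀ (m2 : ℝ) (_hm : 0 < m2) (_hcap : m2 ≤ m0sq) (j : KingVolIndex d) (n : ℕ) (_hn : 1 ≤ n),
      Prop38PrintedAt α (kingTwoSpacingH L a m2 j n) C δ₀ γ := by
  set γ₀ : ℝ := (1 - α) / 2 with hγ₀
  have hγ₀0 : 0 < γ₀ := by rw [hγ₀]; linarith
  have hγ₀1 : γ₀ < 1 := by rw [hγ₀]; linarith
  have hαγ : α + γ₀ < 1 := by rw [hγ₀]; linarith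
  obtain ⟨C₁, δ₁, hC₁, hδ₁, H₁⟩ := line1_kingTwoSpacingH_unif (d := d) L hLodd hL ha hm0 hγ₀0.le hγ₀1.le
  obtain ⟨C₂, δ₂, hC₂, hδ₂, H₂⟩ := line2_kingTwoSpacingH_unif (d := d) L hLodd hL ha hm0 hγ₀0.le hγ₀1
  obtain ⟨C₃, δ₃, hC₃, hδ₃, H₃⟩ := line3_kingTwoSpacingH_unif (d := d) L hLodd hL ha hm0 hα0 hγ₀0 hαγ.le
  obtain ⟨C₄, δ₄, hC₄, hδ₄, H₄⟩ := line4_kingTwoSpacingH_unif (d := d) L hLodd hL ha hm0 hα0 hγ₀0 hαγ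
  set C : ℝ := max (max C₁ C₂) (max C₃ C₄) with hCdef
  set δ : ℝ := min (min δ₁ δ₂) (min δ₃ δ₄) with hδdef
  have hC1 : C₁ ≤ C := (le_max_left _ _).trans (le_max_left _ _)
  have hC2 : C₂ ≤ C := (le_max_right _ _).trans (le_max_left _ _)
  have hC3 : C₃ ≤ C := (le_max_left _ _).trans (le_max_right _ _)
  have hC4 : C₄ ≤ C := (le_max_right _ _).trans (le_max_right _ _)
  have hd1 : δ ≤ δ₁ := (min_le_left _ _).trans (min_le_left _ _)
  have hd2 : δ ≤ δ₂ := (min_le_left _ _).trans (min_le_right _ _)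
  have hd3 : δ ≤ δ₃ := (min_le_right _ _).trans (min_le_left _ _)
  have hd4 : δ ≤ δ₄ := (min_le_right _ _).trans (min_le_right _ _)
  have hδ : 0 < δ := lt_min (lt_min hδ₁ hδ₂) (lt_min hδ₃ hδ₄)
  have hCpos : 0 < C := hC₁.trans_le hC1
  refine ⟨C, δ, γ₀ / 2, hCpos, hδ, half_pos hγ₀0, fun m2 hm hcap j n hn => ?_⟩
  haveI := kingVol_neZero L j
  have weaken : ∀ {Ci δi r t X : ℝ}, Ci ≤ C → δ ≤ δi → 0 ≤ r → 0 ≤ t →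
      X ≤ Ci * r * Real.exp (-(δi * t)) → X ≤ C * r * Real.exp (-(δ * t)) := by
    intro Ci δi r t X hCi hδi hr ht hX
    refine hX.trans ?_
    have he : Real.exp (-(δi * t)) ≤ Real.exp (-(δ * t)) :=
      Real.exp_le_exp.mpr (neg_le_neg (mul_le_mul_of_nonneg_right hδi ht))
    calc Ci * r * Real.exp (-(δi * t)) ≤ C * r * Real.exp (-(δi * t)) :=
          mul_le_mul_of_nonneg_right (mul_le_mul_of_nonneg_right hCi hr) (Real.exp_pos _).le
      _ ≤ C * r * Real.exp (-(δ * t)) := mul_le_mul_of_nonneg_left he (mul_nonneg hCpos.le hr)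
  have hr : 0 ≤ ((kingTwoSpacingH L a m2 j n).lo.L : ℝ) ^ (-(γ₀ / 2 * (kingTwoSpacingH L a m2 j n).lo.k)) :=
    Real.rpow_nonneg (Nat.cast_nonneg _) _
  have hdist : ∀ u z : (kingTwoSpacingH L a m2 j n).lo.S, 0 ≤ (kingTwoSpacingH L a m2 j n).lo.dist u z :=
    fun u z => holdist_nonneg (L ^ j.K) (kingVol L j) u z
  refine ⟨fun x' z _ => ⟨?_, fun μ => ?_⟩, fun x' y' z _ _ _ => ⟨?_, fun μ => ?_⟩⟩
  · exact weaken hC1 hd1 hr (hdist _ _) (H₁ m2 hm hcap j n hn x' z)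
  · exact weaken hC2 hd2 hr (hdist _ _) (H₂ m2 hm hcap j n hn x' z μ)
  · exact weaken hC3 hd3 hr (le_min (hdist _ _) (hdist _ _)) (H₃ m2 hm hcap j n hn x' y' z)
  · exact weaken hC4 hd4 hr (le_min (hdist _ _) (hdist _ _)) (H₄ m2 hm hcap j n hn x' y' z μ)

/-- PART 52's fixed-mass statement IS the cap-`m²` case of the mass-uniform one (consistency of the two assemblies; the constants differ). [folklore] -/
theorem prop38PrintedAt_kingTwoSpacingH_of_unif (hLodd : Odd L) (hL : 2 ≤ L) {a m2 : ℝ} (ha : 0 < a) (hm : 0 < m2) {α : ℝ}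
    (hα0 : 0 < α) (hα1 : α < 1) :
    ∃ C δ₀ γ : ℝ, 0 < C ∧ 0 < δ₀ ∧ 0 < γ ∧ ∀ (j : KingVolIndex d) (n : ℕ) (_hn : 1 ≤ n),
      Prop38PrintedAt α (kingTwoSpacingH L a m2 j n) C δ₀ γ := by
  obtain ⟨C, δ₀, γ, hC, hδ₀, hγ, H⟩ := prop38PrintedAt_kingTwoSpacingH_unif (d := d) L hLodd hL ha hm.le hα0 hα1
  exact ⟨C, δ₀, γ, hC, hδ₀, hγ, fun j n hn => H m2 hm le_rfl j n hn⟩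

end Summit.QuantumFields.YangMills.BalabanUVNodes.N15.KingModel

end
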